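import Summits.ResolutionOfSingularities.ResolutionOfSingularities.Theorems.RisoCentresResolve.Negative.RisoCentresResolveBddLettersHahn

/-!
# Crux `RisoCentresResolve` (stmt-ResolutionOfSingularities-18546) — negative lemma "bounded letters are
# not enough", part 2/4: typed riso-triviality dimension `≥ D+1` everywhere on `cusp × 𝔸^{D+1}`

Support file of `RisoCentresResolveFalseWithBoundedLetters` (route `ResolutionOfSingularities/RisoStrata`,
crux `RisoCentresResolve`).  `bddLetters_rtd`: for `T, z₀, …, z_D` algebraically independent in `K ⊇ k`
(`k` algebraically closed) and `B₀ = k[T², T³, z]`, the crux's INLINE predicate `Rtd B₀ m r` (displayed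
verbatim, `Arc` unfolded) holds at EVERY maximal ideal `m` of `B₀` for every `r ≤ D + 1`.  Witness:
the `D+3` generators shifted into `m` (the point is `k`-rational by the Nullstellensatz), `W` = the `D+1`
coordinate directions of the factor `𝔸^{D+1}`, the IDENTITY straightener `φ a i = a (g i)` (so the
rv-clause is "distinct arcs differ at a generator"), and translated arcs obtained by re-evaluating the
polynomial presentation `k[x, z] ≅ Pol ⊇ B₀` at `(x, a z + w)` where `x² = a T², x³ = a T³`
(`x = a T³ / a T²` or `0`); positivity of the new arc on `m` is the Hahn helper
`bddLetters_orderTop_pos_of_ker`.  This is the typed form of "an equisingular PRODUCT family of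
dimension `D+1` has riso-triviality dimension `≥ D+1` at each of its points, singular or not".
No definitions; kernel-only.
-/

set_option linter.dupNamespace false

namespace Summit.ResolutionOfSingularities.ResolutionOfSingularities.Theorems

open Polynomial

section Rtd

variable {k K : Type} [Field k] [IsAlgClosed k] [Field K] [Algebra k K] {D : ℕ}

/-- **Typed riso-triviality `≥ D+1` everywhere on `cusp × 𝔸^{D+1}`.** For `T, z₀, …, z_D`
algebraically independent in `K ⊇ k` (`k` algebraically closed) and `B₀ = k[T², T³, z]`, the crux's
inline predicate `Rtd B₀ m r` holds at EVERY maximal ideal `m` of `B₀` for every `r ≤ D + 1`: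
generators `gᵢ` = the `D+3` generators shifted into `m`, `W` = the `z`-coordinate directions, the
IDENTITY straightener `φ a i = a (g i)`, and the translated arc `b` obtained by re-evaluating the
polynomial presentation at `(x, a z + w)` where `x² = a T², x³ = a T³`. [folklore] -/
theorem bddLetters_rtd (T : K) (z : Fin (D + 1) → K)
    (hind : Function.Injective
      (MvPolynomial.aeval (Fin.cons T z : Fin (D + 2) → K) : MvPolynomial (Fin (D + 2)) k →ₐ[k] K))
    (B₀ : Subalgebra k K) (hB₀ : B₀ = Algebra.adjoin k (insert (T ^ 2) (insert (T ^ 3) (Set.range z))))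
    (m : Ideal ↥B₀) (hm : m.IsMaximal) (r : ℕ) (hr : r ≤ D + 1) :
    ∃ (n : ℕ) (g : Fin n → ↥B₀), (∀ i, g i ∈ m) ∧ Algebra.adjoin k (Set.range fun i => (g i : K)) = B₀ ∧
      ∃ W : Submodule k (Fin n → k), r ≤ Module.finrank k ↥W ∧
      ∃ φ : {α : ↥B₀ →ₐ[k] HahnSeries ℚ k // ∀ b ∈ m, 0 < (α b).orderTop} → (Fin n → HahnSeries ℚ k),
        (∀ a b : {α : ↥B₀ →ₐ[k] HahnSeries ℚ k // ∀ b ∈ m, 0 < (α b).orderTop}, a ≠ b →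
          ∃ j, ∀ i, (a.1 (g j) - b.1 (g j)).orderTop < ((φ a i - φ b i) - (a.1 (g i) - b.1 (g i))).orderTop) ∧
        (∀ a i, 0 < (φ a i).orderTop) ∧
        (∀ a, ∀ w : Fin n → HahnSeries ℚ k, (∀ i, 0 < (w i).orderTop) →
          w ∈ Submodule.span (HahnSeries ℚ k)
            ((fun u : Fin n → k => fun i => HahnSeries.C (u i)) '' (W : Set (Fin n → k))) →
          ∃ b, φ b = φ a + w) := by
  classical
  have hT2 : T ^ 2 ∈ B₀ := by rw [hB₀]; exact Algebra.subset_adjoin (Set.mem_insert _ _)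
  have hT3 : T ^ 3 ∈ B₀ := by
    rw [hB₀]; exact Algebra.subset_adjoin (Set.mem_insert_of_mem _ (Set.mem_insert _ _))
  have hz : ∀ i, z i ∈ B₀ := fun i => by
    rw [hB₀]
    exact Algebra.subset_adjoin (Set.mem_insert_of_mem _ (Set.mem_insert_of_mem _ ⟨i, rfl⟩))
  let e2 : ↥B₀ := ⟨T ^ 2, hT2⟩
  let e3 : ↥B₀ := ⟨T ^ 3, hT3⟩
  let ez : Fin (D + 1) → ↥B₀ := fun i => ⟨z i, hz i⟩
  -- `m` is `k`-rational: the character `ε : B₀ → k` with kernel `m`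
  haveI : Algebra.FiniteType k ↥B₀ := by
    rw [hB₀]
    exact Algebra.FiniteType.adjoin_of_finite (((Set.finite_range z).insert _).insert _)
  letI : Field (↥B₀ ⧸ m) := Ideal.Quotient.field m
  haveI : Module.Finite k (↥B₀ ⧸ m) := finite_of_finite_type_of_isJacobsonRing k (↥B₀ ⧸ m)
  haveI : Algebra.IsIntegral k (↥B₀ ⧸ m) := Algebra.IsIntegral.of_finite k _
  have hbij := IsAlgClosed.algebraMap_bijective_of_isIntegral (k := k) (K := ↥B₀ ⧸ m)
  let eK : k ≃ₐ[k] (↥B₀ ⧸ m) := AlgEquiv.ofBijective (Algebra.ofId k (↥B₀ ⧸ m)) hbij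
  let ε : ↥B₀ →ₐ[k] k := eK.symm.toAlgHom.comp (Ideal.Quotient.mkₐ k m)
  have hε : ∀ a, ε a = 0 ↔ a ∈ m := fun a => by
    change eK.symm (Ideal.Quotient.mk m a) = 0 ↔ a ∈ m
    rw [map_eq_zero_iff _ eK.symm.injective, Ideal.Quotient.eq_zero_iff_mem]
  -- generators, shifted into `m`
  let gB : Fin (D + 3) → ↥B₀ := Fin.cons e2 (Fin.cons e3 ez)
  let g : Fin (D + 3) → ↥B₀ := fun i => gB i - algebraMap k ↥B₀ (ε (gB i))
  have hgm : ∀ i, g i ∈ m := fun i => (hε _).mp (by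
    simp only [g, map_sub, AlgHom.commutes, Algebra.algebraMap_self, RingHom.id_apply, sub_self])
  have hgB0 : gB 0 = e2 := rfl
  have hgB1 : gB 1 = e3 := rfl
  have hgBs : ∀ j : Fin (D + 1), gB j.succ.succ = ez j := fun j => rfl
  have hcoe : ∀ i, (g i : K) = (gB i : K) - algebraMap k K (ε (gB i)) := fun i => by
    simp only [g, Subalgebra.coe_sub, Subalgebra.coe_algebraMap]
  -- the shifted generators generate `B₀`
  have hgenK : Algebra.adjoin k (Set.range fun i => (g i : K)) = B₀ := by
    apply le_antisymm
    · exact Algebra.adjoin_le (by rintro _ ⟨i, rfl⟩; exact (g i).2)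
    · have hmem : ∀ i, (gB i : K) ∈ Algebra.adjoin k (Set.range fun i => (g i : K)) := fun i => by
        have : (gB i : K) = (g i : K) + algebraMap k K (ε (gB i)) := by rw [hcoe]; ring
        rw [this]
        exact add_mem (Algebra.subset_adjoin ⟨i, rfl⟩) (Subalgebra.algebraMap_mem _ _)
      intro y hy
      rw [hB₀] at hy
      refine Algebra.adjoin_le ?_ hy
      rintro y (rfl | rfl | ⟨j, rfl⟩)
      · exact hmem 0
      · exact hmem 1
      · exact hmem j.succ.succ
  have hgenTop : Algebra.adjoin k (Set.range g) = ⊤ := by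
    apply Subalgebra.map_injective (f := B₀.val) Subtype.val_injective
    rw [AlgHom.map_adjoin, Algebra.map_top, Subalgebra.range_val, ← Set.range_comp]
    exact hgenK
  have hsurj : Function.Surjective
      (MvPolynomial.aeval g : MvPolynomial (Fin (D + 3)) k →ₐ[k] ↥B₀) := by
    rw [← AlgHom.range_eq_top, ← Algebra.adjoin_range_eq_range_aeval, hgenTop]
  have hεg : ∀ i, ε (g i) = 0 := fun i => (hε _).mpr (hgm i)
  -- the polynomial model `k[x, z] ≅ Pol ⊇ B₀`
  let Pol : Subalgebra k K := (MvPolynomial.aeval (Fin.cons T z : Fin (D + 2) → K)).range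
  let PolE : MvPolynomial (Fin (D + 2)) k ≃ₐ[k] ↥Pol := AlgEquiv.ofInjective _ hind
  have hB₀Pol : B₀ ≤ Pol := by
    intro y hy
    rw [hB₀] at hy
    refine Algebra.adjoin_le ?_ hy
    rintro y (rfl | rfl | ⟨j, rfl⟩)
    · refine ⟨MvPolynomial.X 0 ^ 2, ?_⟩
      change MvPolynomial.aeval (Fin.cons T z : Fin (D + 2) → K) (MvPolynomial.X 0 ^ 2) = T ^ 2
      rw [map_pow, MvPolynomial.aeval_X, Fin.cons_zero]
    · refine ⟨MvPolynomial.X 0 ^ 3, ?_⟩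
      change MvPolynomial.aeval (Fin.cons T z : Fin (D + 2) → K) (MvPolynomial.X 0 ^ 3) = T ^ 3
      rw [map_pow, MvPolynomial.aeval_X, Fin.cons_zero]
    · refine ⟨MvPolynomial.X j.succ, ?_⟩
      change MvPolynomial.aeval (Fin.cons T z : Fin (D + 2) → K) (MvPolynomial.X j.succ) = z j
      rw [MvPolynomial.aeval_X, Fin.cons_succ]
  -- the translation directions: the `z`-coordinates
  let W : Submodule k (Fin (D + 3) → k) :=
    Submodule.span k (Set.range fun j : Fin (D + 1) => (Pi.single j.succ.succ (1 : k) : Fin (D + 3) → k))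
  have hWrank : Module.finrank k ↥W = D + 1 := by
    have hli : LinearIndependent k
        (fun j : Fin (D + 1) => (Pi.single j.succ.succ (1 : k) : Fin (D + 3) → k)) := by
      have h := (Pi.basisFun k (Fin (D + 3))).linearIndependent
      have h2 := h.comp (fun j : Fin (D + 1) => j.succ.succ)
        (fun a b hab => Fin.succ_injective _ (Fin.succ_injective _ hab))
      convert h2 using 1
      funext j
      simp [Pi.basisFun_apply]
    rw [finrank_span_eq_card hli, Fintype.card_fin]
  have hW01 : ∀ u ∈ W, u 0 = 0 ∧ u 1 = 0 := by
    intro u hu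
    induction hu using Submodule.span_induction with
    | mem x hx =>
      obtain ⟨j, rfl⟩ := hx
      refine ⟨Pi.single_eq_of_ne (Fin.succ_ne_zero _).symm _, Pi.single_eq_of_ne ?_ _⟩
      intro h10
      have : (j.succ.succ : Fin (D + 3)) = (0 : Fin (D + 2)).succ := h10.symm ▸ rfl
      exact Fin.succ_ne_zero _ (Fin.succ_injective _ this)
    | zero => exact ⟨rfl, rfl⟩
    | add x y _ _ hx hy => exact ⟨by rw [Pi.add_apply, hx.1, hy.1, add_zero],
        by rw [Pi.add_apply, hx.2, hy.2, add_zero]⟩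
    | smul c x _ hx => exact ⟨by rw [Pi.smul_apply, hx.1, smul_zero],
        by rw [Pi.smul_apply, hx.2, smul_zero]⟩
  -- assemble
  refine ⟨D + 3, g, hgm, hgenK, W, by rw [hWrank]; exact hr, fun a i => a.1 (g i), ?_,
    fun a i => a.2 _ (hgm i), ?_⟩
  · -- rv-separation for the identity straightener
    intro a b hab
    have hj : ∃ j, a.1 (g j) ≠ b.1 (g j) := by
      by_contra hall
      push Not at hall
      apply hab
      apply Subtype.ext
      apply AlgHom.ext
      intro x
      obtain ⟨q, rfl⟩ := hsurj x
      rw [← AlgHom.comp_apply, MvPolynomial.comp_aeval, ← AlgHom.comp_apply, MvPolynomial.comp_aeval]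
      exact congrArg (fun u => MvPolynomial.aeval u q) (funext hall)
    obtain ⟨j, hj⟩ := hj
    refine ⟨j, fun i => ?_⟩
    rw [sub_self, HahnSeries.orderTop_zero, WithTop.lt_top_iff_ne_top, Ne, HahnSeries.orderTop_eq_top,
      sub_eq_zero]
    exact hj
  · -- translation along `W`
    intro a w hw hwW
    have hw01 : w 0 = 0 ∧ w 1 = 0 := by
      have key : ∀ v ∈ Submodule.span (HahnSeries ℚ k)
          ((fun u : Fin (D + 3) → k => fun i => HahnSeries.C (u i)) '' (W : Set (Fin (D + 3) → k))),
          v 0 = 0 ∧ v 1 = 0 := by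
        intro v hv
        induction hv using Submodule.span_induction with
        | mem x hx =>
          obtain ⟨u, hu, rfl⟩ := hx
          have h := hW01 u hu
          exact ⟨by simp [h.1], by simp [h.2]⟩
        | zero => exact ⟨rfl, rfl⟩
        | add x y _ _ hx hy => exact ⟨by rw [Pi.add_apply, hx.1, hy.1, add_zero],
            by rw [Pi.add_apply, hx.2, hy.2, add_zero]⟩
        | smul c x _ hx => exact ⟨by rw [Pi.smul_apply, hx.1, smul_zero],
            by rw [Pi.smul_apply, hx.2, smul_zero]⟩
      exact key w hwW
    -- the `x`-coordinate of the translated arc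
    set A : HahnSeries ℚ k := a.1 e2 with hA
    set Bv : HahnSeries ℚ k := a.1 e3 with hBv
    have hAB : A ^ 3 = Bv ^ 2 := by
      rw [hA, hBv, ← map_pow, ← map_pow]
      congr 1
      apply Subtype.ext
      change (T ^ 2) ^ 3 = (T ^ 3) ^ 2
      ring
    let xv : HahnSeries ℚ k := if A = 0 then 0 else Bv / A
    have hx2 : xv ^ 2 = A := by
      by_cases hA0 : A = 0
      · have hB0 : Bv = 0 := pow_eq_zero_iff two_ne_zero |>.mp (by rw [← hAB, hA0]; ring)
        simp [xv, hA0]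
      · have : xv = Bv / A := if_neg hA0
        rw [this, div_pow, ← hAB, pow_succ, mul_div_cancel_left₀ _ (pow_ne_zero 2 hA0)]
    have hx3 : xv ^ 3 = Bv := by
      by_cases hA0 : A = 0
      · have hB0 : Bv = 0 := pow_eq_zero_iff two_ne_zero |>.mp (by rw [← hAB, hA0]; ring)
        simp [xv, hA0, hB0]
      · have hB0 : Bv ≠ 0 := fun h0 => hA0 (pow_eq_zero_iff three_ne_zero |>.mp (by rw [hAB, h0]; ring))
        have : xv = Bv / A := if_neg hA0
        rw [this, div_pow, hAB, pow_succ, mul_div_cancel_left₀ _ (pow_ne_zero 2 hB0)]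
    let vals : Fin (D + 2) → HahnSeries ℚ k := Fin.cons xv (fun j => a.1 (ez j) + w j.succ.succ)
    let β : ↥B₀ →ₐ[k] HahnSeries ℚ k :=
      ((MvPolynomial.aeval vals).comp (PolE.symm : ↥Pol →ₐ[k] MvPolynomial (Fin (D + 2)) k)).comp
        (Subalgebra.inclusion hB₀Pol)
    have hβ : ∀ (x : ↥B₀) (q : MvPolynomial (Fin (D + 2)) k),
        (x : K) = MvPolynomial.aeval (Fin.cons T z : Fin (D + 2) → K) q →
          β x = MvPolynomial.aeval vals q := by
      intro x q hxq
      have hincl : Subalgebra.inclusion hB₀Pol x = PolE q := by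
        apply Subtype.ext
        rw [AlgEquiv.ofInjective_apply]
        exact hxq
      change MvPolynomial.aeval vals (PolE.symm (Subalgebra.inclusion hB₀Pol x)) = _
      rw [hincl, AlgEquiv.symm_apply_apply]
    have hβ2 : β e2 = A := by
      rw [hβ e2 (MvPolynomial.X 0 ^ 2) (by rw [map_pow, MvPolynomial.aeval_X, Fin.cons_zero]),
        map_pow, MvPolynomial.aeval_X]
      exact hx2
    have hβ3 : β e3 = Bv := by
      rw [hβ e3 (MvPolynomial.X 0 ^ 3) (by rw [map_pow, MvPolynomial.aeval_X, Fin.cons_zero]),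
        map_pow, MvPolynomial.aeval_X]
      exact hx3
    have hβz : ∀ j, β (ez j) = a.1 (ez j) + w j.succ.succ := fun j => by
      rw [hβ (ez j) (MvPolynomial.X j.succ) (by rw [MvPolynomial.aeval_X, Fin.cons_succ]),
        MvPolynomial.aeval_X]
      rfl
    have hβgB : ∀ i, β (gB i) = a.1 (gB i) + w i := by
      intro i
      refine Fin.cases ?_ (fun i => ?_) i
      · rw [hgB0, hβ2, hw01.1, add_zero]
      · refine Fin.cases ?_ (fun j => ?_) i
        · change β (gB 1) = a.1 (gB 1) + w 1
          rw [hgB1, hβ3, hw01.2, add_zero]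
        · rw [hgBs j, hβz j]
    have hβg : ∀ i, β (g i) = a.1 (g i) + w i := fun i => by
      simp only [g, map_sub, AlgHom.commutes, hβgB i]
      ring
    have hβpos : ∀ i, 0 < (β (g i)).orderTop := fun i => by
      rw [hβg i]
      exact (lt_min (a.2 _ (hgm i)) (hw i)).trans_le HahnSeries.min_orderTop_le_orderTop_add
    refine ⟨⟨β, fun b hb => bddLetters_orderTop_pos_of_ker g hsurj ε hεg β hβpos b ((hε b).mpr hb)⟩, ?_⟩
    funext i
    exact hβg i

end Rtd

end Summit.ResolutionOfSingularities.ResolutionOfSingularities.Theorems
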